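import Summits.QuantumFields.YangMills.Theorems.GronwallGapAnalyticDetourReduction
import Summits.QuantumFields.YangMills.Theorems.GronwallGapAnalyticDetourStubWilsonSegmentAdm
import Summits.QuantumFields.YangMills.Theorems.GronwallGapAnalyticDetourStubExpPosSemidef

/-!
# Crux `AnalyticDetour` (stmt-QuantumFields-8801), line `registered`:
# the crossover case — Wilson-axis Gateaux-analyticity gives the anchored detour with `E = ∅`

Route `GronwallGap`, sub-problem `YangMills`.  The open core of the crux (`stub_anchoredDetour`)
asks, for each compact simple `G` and lattice representation `r`, for admissible weight paths
with Gateaux-analytic torus pressure from anchors arbitrarily deep in strong coupling to every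
Wilson point `β ∉ E`, `E` locally finite.  For the groups whose Wilson axis is expected to carry
NO bulk transition at all (the "crossover-only" cases, e.g. `SU(2)`, `SU(3)` in the fundamental
representation — Monte-Carlo lore, Bhanot–Creutz 1981, Lucini–Teper–Wenger 2005; nothing is
proved beyond the strong-coupling window) the natural conjecture is

  `WilsonAxisAnalytic (G, r)`: for every `β > 0` the Wilson weight `exp(β Re tr r.ρ)` has
  Gateaux-analytic torus pressure in every continuous class-function direction (`AnP`).

This file proves the CONDITIONAL BRIDGE, per `(G, r)`:
`WilsonAxisAnalytic (G, r) → anchored detour for (G, r)` with `E = ∅`, anchor `βa := b/2`, and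
the straight Wilson segment `s ↦ exp(((1-s)βa + sβ) Re tr r.ρ)` as the witness (admissible by the
landed `stub_wilsonSegmentAdm`; analytic at every parameter because the running coupling
`(1-s)βa + sβ` stays `> 0`).  Quantified over all `(G, r)` it yields the crux
(`analyticDetour_of_wilsonAxisAnalytic`, through the landed reduction
`stub_reductionToAnchoredDetour`) — but NOTE: axis analyticity for ALL `(G, r)` is expected to be
FALSE (first-order bulk transitions on the Wilson axis of `SU(N ≥ 5)`, `SO(3)`-like and
large-representation actions), so the universally quantified corollary is recorded only as the
formal shape of the dependency; the per-`(G, r)` bridge is the meaningful statement.  For the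
first-order-wall groups the open core needs a genuine DETOUR off the axis (positive-type weights
around the endpoint of the wall), which this file does not touch.

Both theorems are CONDITIONAL (hypothesis = open conjecture); they close nothing by themselves.
No named facts; no definitions.
-/

noncomputable section

namespace Summit.QuantumFields.YangMills.Theorems

open scoped BigOperators

/-- **Crossover bridge (per `(G, r)`).**  If the Wilson weight `exp(β Re tr r.ρ)` has
Gateaux-analytic torus pressure in every continuous class direction at EVERY `β > 0`, then the
anchored-detour statement holds for `(G, r)` with `E = ∅`: from the anchor `βa := b/2 ∈ (0, b)`
the straight Wilson segment `s ↦ exp(((1-s)βa + sβ) Re tr r.ρ)` reaches `β`; it is admissible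
(`stub_wilsonSegmentAdm`), and analytic at every parameter since `(1-s)βa + sβ > 0` on `[0,1]`. -/
theorem stub_anchoredDetourOfAxisAnalytic :
    ∀ (G : Type) [Group G] [TopologicalSpace G] [IsTopologicalGroup G] [CompactSpace G], Literature.MathematicalPhysics.QuantumFieldTheory.IsCompactSimpleLieGroup G → letI : MeasurableSpace G := borel G; haveI : BorelSpace G := ⟨rfl⟩; let Pseq : (G → ℝ) → ℕ → ℝ := fun v L => (((L + 1 : ℕ) : ℝ) ^ 4)⁻¹ * Real.log (((MeasureTheory.Measure.pi fun _ : Literature.MathematicalPhysics.QuantumFieldTheory.Edge 4 (L + 1) => Literature.MathematicalPhysics.QuantumFieldTheory.haarProbability G).withDensity (fun U : Literature.MathematicalPhysics.QuantumFieldTheory.GaugeConfig 4 (L + 1) G => ENNReal.ofReal (Literature.MathematicalPhysics.QuantumLattice.groupHeatKernelWeight (fun _ : ℝ => v) 0 U))) Set.univ).toReal; let AnP : (G → ℝ) → Prop := fun v => ∀ φ : G → ℝ, Continuous φ → (∀ g h : G, φ (h * g * h⁻¹) = φ g) → ∃ p : ℝ → ℝ, (∀ t : ℝ, Filter.Tendsto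 (fun L : ℕ => Pseq (fun g => v g * Real.exp (t * φ g)) L) Filter.atTop (nhds (p t))) ∧ AnalyticAt ℝ p 0; let Adm : (ℝ → G → ℝ) → Prop := fun w => (∀ s ∈ Set.Icc (0 : ℝ) 1, Continuous (w s) ∧ (∀ g : G, 0 < w s g) ∧ (∀ g h : G, w s (h * g * h⁻¹) = w s g) ∧ (∀ g : G, w s g⁻¹ = w s g) ∧ (∀ (n : ℕ) (x : Fin n → G) (c : Fin n → ℂ), 0 ≤ (∑ i, ∑ j, (starRingEnd ℂ) (c i) * c j * ((w s ((x i)⁻¹ * x j) : ℝ) : ℂ)).re)) ∧ ∃ Λ : ℝ, ∀ s ∈ Set.Icc (0 : ℝ) 1, ∀ s' ∈ Set.Icc (0 : ℝ) 1, ∀ g : G, |Real.log (w s g) - Real.log (w s' g)| ≤ Λ * |s - s'|; ∀ r : Literature.MathematicalPhysics.QuantumFieldTheory.LatticeRep G, (∀ β : ℝ, 0 < β → AnP (fun g => Real.exp (β * (r.ρ g).trace.re))) → ∃ E : Set ℝ, (∀ b : ℝ, (E ∩ Set.Icc 0 b).Finite) ∧ ∀ b : ℝ, 0 < b → ∃ βa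 ∈ Set.Ioo (0 : ℝ) b, ∀ β : ℝ, 0 < β → β ∉ E → ∃ w : ℝ → G → ℝ, Adm w ∧ (∀ s ∈ Set.Icc (0 : ℝ) 1, AnP (w s)) ∧ w 0 = (fun g => Real.exp (βa * (r.ρ g).trace.re)) ∧ w 1 = (fun g => Real.exp (β * (r.ρ g).trace.re)) := by
  intro G i1 i2 i3 i4 hG Pseq AnP Adm r hax
  refine ⟨∅, fun b => by simp, fun b hb => ⟨b / 2, ⟨by positivity, by linarith⟩, fun β hβ _ => ?_⟩⟩
  have hAdm := stub_wilsonSegmentAdm stub_expPosSemidef G hG r (b / 2) β (by positivity) hβ.le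
  refine ⟨fun s g => Real.exp (((1 - s) * (b / 2) + s * β) * (r.ρ g).trace.re), hAdm, ?_, ?_, ?_⟩
  · intro s hs
    obtain ⟨hs0, hs1⟩ := hs
    have hpos : 0 < (1 - s) * (b / 2) + s * β := by
      rcases eq_or_lt_of_le hs0 with h0 | h0
      · rw [← h0]; norm_num; exact hb
      · have h1 : 0 ≤ (1 - s) * (b / 2) := mul_nonneg (by linarith) (by positivity)
        have h2 : 0 < s * β := mul_pos h0 hβ
        linarith
    exact hax _ hpos
  · funext g
    norm_num
  · funext g
    norm_num

/-- **Formal corollary (universally quantified; hypothesis expected FALSE in general — see the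
module docstring).**  Wilson-axis Gateaux-analyticity for all compact simple `G` and all lattice
representations `r` would give the crux `AnalyticDetour` (per-`(G, r)` bridge composed with the
landed reduction `stub_reductionToAnchoredDetour`).  Recorded as the shape of the dependency
only; the meaningful statement is the per-`(G, r)` bridge `stub_anchoredDetourOfAxisAnalytic`. -/
theorem analyticDetour_of_wilsonAxisAnalytic :
    (∀ (G : Type) [Group G] [TopologicalSpace G] [IsTopologicalGroup G] [CompactSpace G], Literature.MathematicalPhysics.QuantumFieldTheory.IsCompactSimpleLieGroup G → letI : MeasurableSpace G := borel G; haveI : BorelSpace G := ⟨rfl⟩; let Pseq : (G → ℝ) → ℕ → ℝ := fun v L => (((L + 1 : ℕ) : ℝ) ^ 4)⁻¹ * Real.log (((MeasureTheory.Measure.pi fun _ : Literature.MathematicalPhysics.QuantumFieldTheory.Edge 4 (L + 1) => Literature.MathematicalPhysics.QuantumFieldTheory.haarProbability G).withDensity (fun U : Literature.MathematicalPhysics.QuantumFieldTheory.GaugeConfig 4 (L + 1) G => ENNReal.ofReal (Literature.MathematicalPhysics.QuantumLattice.groupHeatKernelWeight (fun _ : ℝ => v) 0 U))) Set.univ).toReal;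 let AnP : (G → ℝ) → Prop := fun v => ∀ φ : G → ℝ, Continuous φ → (∀ g h : G, φ (h * g * h⁻¹) = φ g) → ∃ p : ℝ → ℝ, (∀ t : ℝ, Filter.Tendsto (fun L : ℕ => Pseq (fun g => v g * Real.exp (t * φ g)) L) Filter.atTop (nhds (p t))) ∧ AnalyticAt ℝ p 0; ∀ r : Literature.MathematicalPhysics.QuantumFieldTheory.LatticeRep G, ∀ β : ℝ, 0 < β → AnP (fun g => Real.exp (β * (r.ρ g).trace.re))) →
    Summit.QuantumFields.YangMills.Theses.GronwallGap.AnalyticDetour := by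
  intro h
  refine stub_reductionToAnchoredDetour ?_
  intro G i1 i2 i3 i4 hG Pseq AnP Adm r
  exact stub_anchoredDetourOfAxisAnalytic G hG r (h G hG r)

end Summit.QuantumFields.YangMills.Theorems

end
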